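import Mathlib
import HarnessLib
import Summits.HubbardSuperconductivity.HubbardSuperconductivity.Theorems.KLProgrammeKLRegimeSplitTwoLegIncrementRep
import Summits.HubbardSuperconductivity.HubbardSuperconductivity.Theorems.KLProgrammeKLRegimeSplitTwoLegIncrementSizes

/-!
# Route `KLProgramme` — K3 gen 8 ENGINE child `KLRegimeEngineV17F2` (stmt-HubbardSuperconductivity-20437), stubs (C)/(e): LAYER 1 of the
# representation export, READING LEVEL — the scale-`n` increment of the self-energy, of the localised two-leg value and of the local part `ν_n(K)`
# at a FIXED frame, as «textbook tadpole + two named remainders» (exact identities; plan g17 l.3124 (2), owner r2d-p1)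

Cell gate-hubbard-kl, seat hubbard-kl-r2d-p1 (g6).  Continues `…TwoLegIncrementRep` (p543420: kernel level).  c4a-1's LAYER 2 (tube tadpoles + corner +
aliasing) and the (A)-lemma of stub (C) read the increment `ν_{n+1}(K) − ν_n(K)` of the cumulative local part at the FIXED frame `K = K_n`
(`klLocalPart_sub_eq_evalM_comp`: it is the interpolant of the lattice increment of `klLocSelfEnergyRe`); this file carries p543420's identity to that
level, so that LAYER 2 starts from ONE name:

* §1 **`selfEnergy_effAction_split`** (any covariance/element: `Σ_{effAction C W} = Σ_W + Σ_{Δ_C W} + Σ_{e^Δ W − W − Δ W} + Σ_{effAction − e^Δ W}`) and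
  **`selfEnergy_grassmannLaplacian_hubbardCovSliceCT`** — THE TEXTBOOK TADPOLE: `Σ_{Δ_S W}(q,σ) = (βL²)⁻²·Σ_{p=(p,τ)} ŝ(ω_p, e_K(p⃗))·𝒱₄ W (ψ̂⁺_{qσ}, ψ̂⁻_{qσ}, ψ̂⁻_{pτ}, ψ̂⁺_{pτ})`,
  `ŝ = sliceSymbolFnXi (βL²) 0 Λ Λ'` (the slice propagator as a function of the LEVEL `e_K = nambuXiCT L μ K`; p1's `vertexFn_grassmannLaplacian_normalCovariance'`);
* §2 **`klSelfEnergy_succ_sub_eq`** — `Σ_{n+1}[K](q,σ) − Σ_n[K](q,σ) = tadpole(𝒱_n[K]) + Σ_{R₁} + Σ_{R₂}` (`Z^K_{Λ_n} ≠ 0`);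
* §3 **`klLocSelfEnergyRe_succ_sub_eq`** — the same for the localised value `¼Σ_σ[Re Σ(ω₀,k⃗,σ) + Re Σ(−ω₀,k⃗,σ)]` (the frame vertex `+K(p)` cancels in the difference);
* §4 **`klLocalPart_succ_sub_eq`** — `ν_{n+1}(K)(θ) − ν_n(K)(θ) = I_L[tadpole reading](k_F^K(θ)) + I_L[R₁ reading](k_F^K(θ)) + I_L[R₂ reading](k_F^K(θ))`
  (`eval_symInterp_add/sub`): the three LAYER-2 inputs BY NAME — the tadpole term is c4a-1's `Σ_{q₀} tube tadpole + corner + aliasing` object, `R₁` = ≥ 2 self-lines,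
  `R₂` = ≥ 2 vertices.

Exact identities only; no estimate, no definition; nothing about the model's sizes is asserted; nothing asserts superconductivity.
References: BGM 2006 §2.2 (2.12)–(2.14), §2.3 (2.17)–(2.23) [cite: BenfattoGiulianiMastropietro2006]; Salmhofer 1998 §5.1 (the tadpole `(βL²)⁻¹Σ ĝ 𝒱₄`)
[cite: Salmhofer1998].
-/

noncomputable section

namespace Summit.HubbardSuperconductivity.HubbardSuperconductivity.Theorems.KLRegimeSplit

set_option linter.dupNamespace false -- summit = problem name (single-conjunct summit), D-0017

open Finset Literature.MathematicalPhysics.QuantumLattice Literature.Probability.LatticeModels GrassmannAlgebra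
open Summit.HubbardSuperconductivity.HubbardSuperconductivity.Theorems.KLProgrammeLegKernels
open Summit.HubbardSuperconductivity.HubbardSuperconductivity.Theorems.KLRegimeWick
open Summit.HubbardSuperconductivity.HubbardSuperconductivity.Theorems.TorusFourierL2

variable {L M : ℕ} [NeZero L]

/-! ## §1 The self-energy of one Gaussian step, split; the textbook tadpole with the slice propagator -/

/-- **The self-energy of `effAction C W`, split EXACTLY** (input · one line · ≥ 2 self-lines · ≥ 2 vertices). -/
theorem selfEnergy_effAction_split (β : ℝ) (C : Matrix (HubbardFieldIdx L M) (HubbardFieldIdx L M) ℂ) (W : HubbardGrassmann L M)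
    (q : FreqMomentum L M) (σ : Fin 2) :
    selfEnergy L M β (effAction ℂ C W) q σ =
      selfEnergy L M β W q σ + selfEnergy L M β (grassmannLaplacian ℂ C W) q σ +
        selfEnergy L M β (gaussConv ℂ C W - W - grassmannLaplacian ℂ C W) q σ +
          selfEnergy L M β (effAction ℂ C W - gaussConv ℂ C W) q σ := by
  simp only [selfEnergy, vertexFn_def]
  rw [kernel_effAction_split]
  ring

/-- **THE TEXTBOOK TADPOLE** (`β ≠ 0`, any frame `K`, cutoffs `Λ, Λ'`, any `W`): the self-energy of `Δ_S W`, `S = C^K_{(Λ,Λ']}`, at `(q, σ)` is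
`(βL²)⁻²·Σ_{p=(p,τ)} ŝ(ω_p, e_K(p⃗))·𝒱₄ W (ψ̂⁺_{qσ}, ψ̂⁻_{qσ}, ψ̂⁻_{pτ}, ψ̂⁺_{pτ})`, `ŝ = sliceSymbolFnXi (βL²) 0 Λ Λ'`. -/
theorem selfEnergy_grassmannLaplacian_hubbardCovSliceCT {β : ℝ} (hβ : β ≠ 0) (μ : ℝ) (K : TrigPolyC4v) (Λ Λ' : ℝ) (W : HubbardGrassmann L M)
    (q : FreqMomentum L M) (σ : Fin 2) :
    selfEnergy L M β (grassmannLaplacian ℂ (hubbardCovSliceCT L M β μ 0 K Λ Λ') W) q σ =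
      ((((β * (L : ℝ) ^ 2) ^ 2 : ℝ) : ℂ))⁻¹ *
        ∑ p : FreqMomentum L M × Fin 2,
          sliceSymbolFnXi (β * (L : ℝ) ^ 2) 0 Λ Λ' (matsubaraFreq β M p.1.1) (nambuXiCT L μ K p.1.2) *
            vertexFn L M β W (2 + 2)
              (Fin.snoc (Fin.snoc (![((q, σ), 0), ((q, σ), 1)] : Fin 2 → HubbardFieldIdx L M) ((p, 1) : HubbardFieldIdx L M) :
                Fin (2 + 1) → HubbardFieldIdx L M) (p, 0)) := by
  unfold selfEnergy
  rw [hubbardCovSliceCT_eq_normalCovariance_sliceSymbolFnXi hβ μ K Λ Λ', vertexFn_grassmannLaplacian_normalCovariance' L M hβ _ _ (by norm_num)]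

/-! ## §2 The scale-`n` increment of the self-energy at a fixed frame -/

/-- **`Σ_{n+1}[K](q,σ) − Σ_n[K](q,σ) = tadpole + Σ_{R₁} + Σ_{R₂}`** (`β ≠ 0`, `Z^K_{Λ_n} ≠ 0`): the tadpole of the slice propagator `ŝ_{n+1}` (a function of the
level `e_K`) on the four-leg vertex function of the INPUT `𝒱_n[K]`, plus the self-energies of the two remainders `R₁ = e^{Δ_S}𝒱_n − 𝒱_n − Δ_S𝒱_n` (≥ 2 self-lines)
and `R₂ = effAction S 𝒱_n − e^{Δ_S}𝒱_n` (≥ 2 vertices), `S = C^K_{(Λ_{n+1},Λ_n]}`. -/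
theorem klSelfEnergy_succ_sub_eq {β : ℝ} (hβ : β ≠ 0) (U μ : ℝ) (K : TrigPolyC4v) (n : ℕ)
    (hZ : hubbardEffPartitionFnCT L M β U μ 0 K (klScale klE0 n) ≠ 0) (q : FreqMomentum L M) (σ : Fin 2) :
    klSelfEnergy L M β U μ K klE0 (n + 1) q σ - klSelfEnergy L M β U μ K klE0 n q σ =
      ((((β * (L : ℝ) ^ 2) ^ 2 : ℝ) : ℂ))⁻¹ *
          ∑ p : FreqMomentum L M × Fin 2,
            sliceSymbolFnXi (β * (L : ℝ) ^ 2) 0 (klScale klE0 (n + 1)) (klScale klE0 n) (matsubaraFreq β M p.1.1) (nambuXiCT L μ K p.1.2) *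
              vertexFn L M β (klEffectiveAction L M β U μ K klE0 n) (2 + 2)
                (Fin.snoc (Fin.snoc (![((q, σ), 0), ((q, σ), 1)] : Fin 2 → HubbardFieldIdx L M) ((p, 1) : HubbardFieldIdx L M) :
                  Fin (2 + 1) → HubbardFieldIdx L M) (p, 0)) +
        selfEnergy L M β
            (gaussConv ℂ (hubbardCovSliceCT L M β μ 0 K (klScale klE0 (n + 1)) (klScale klE0 n)) (klEffectiveAction L M β U μ K klE0 n) -
              klEffectiveAction L M β U μ K klE0 n -
              grassmannLaplacian ℂ (hubbardCovSliceCT L M β μ 0 K (klScale klE0 (n + 1)) (klScale klE0 n))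
                (klEffectiveAction L M β U μ K klE0 n)) q σ +
        selfEnergy L M β
            (effAction ℂ (hubbardCovSliceCT L M β μ 0 K (klScale klE0 (n + 1)) (klScale klE0 n)) (klEffectiveAction L M β U μ K klE0 n) -
              gaussConv ℂ (hubbardCovSliceCT L M β μ 0 K (klScale klE0 (n + 1)) (klScale klE0 n)) (klEffectiveAction L M β U μ K klE0 n)) q σ := by
  unfold klSelfEnergy
  rw [klEffectiveAction_succ_eq_effAction_slice β U μ K klE0 n hZ, selfEnergy_effAction_split,
    selfEnergy_grassmannLaplacian_hubbardCovSliceCT hβ]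
  ring

/-! ## §3 The scale-`n` increment of the localised two-leg value `klLocSelfEnergyRe` -/

variable [NeZero M]

/-- **The localised two-leg value's increment at a fixed frame** (`β ≠ 0`, `Z^K_{Λ_n} ≠ 0`): for every torus momentum `k⃗`,
`klLocSelfEnergyRe … K (n+1) k⃗ − klLocSelfEnergyRe … K n k⃗ = ¼Σ_σ[Re T(ω₀,k⃗,σ) + Re T(−ω₀,k⃗,σ)] + ¼Σ_σ[Re Σ_{R₁}(±ω₀,k⃗,σ)] + ¼Σ_σ[Re Σ_{R₂}(±ω₀,k⃗,σ)]`, `T` the tadpole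
of §2 (the frame vertex `+K(p_k⃗)` inside both values cancels). -/
theorem klLocSelfEnergyRe_succ_sub_eq {β : ℝ} (hβ : β ≠ 0) (U μ : ℝ) (K : TrigPolyC4v) (n : ℕ)
    (hZ : hubbardEffPartitionFnCT L M β U μ 0 K (klScale klE0 n) ≠ 0) (k : TorusSite 2 L) :
    klLocSelfEnergyRe L M β U μ K (n + 1) k - klLocSelfEnergyRe L M β U μ K n k =
      (∑ σ : Fin 2,
          ((((((β * (L : ℝ) ^ 2) ^ 2 : ℝ) : ℂ))⁻¹ *
              ∑ p : FreqMomentum L M × Fin 2,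
                sliceSymbolFnXi (β * (L : ℝ) ^ 2) 0 (klScale klE0 (n + 1)) (klScale klE0 n) (matsubaraFreq β M p.1.1) (nambuXiCT L μ K p.1.2) *
                  vertexFn L M β (klEffectiveAction L M β U μ K klE0 n) (2 + 2)
                    (Fin.snoc (Fin.snoc (![(((omega0 M, k), σ), 0), (((omega0 M, k), σ), 1)] : Fin 2 → HubbardFieldIdx L M)
                      ((p, 1) : HubbardFieldIdx L M) : Fin (2 + 1) → HubbardFieldIdx L M) (p, 0))).re +
            (((((β * (L : ℝ) ^ 2) ^ 2 : ℝ) : ℂ))⁻¹ *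
              ∑ p : FreqMomentum L M × Fin 2,
                sliceSymbolFnXi (β * (L : ℝ) ^ 2) 0 (klScale klE0 (n + 1)) (klScale klE0 n) (matsubaraFreq β M p.1.1) (nambuXiCT L μ K p.1.2) *
                  vertexFn L M β (klEffectiveAction L M β U μ K klE0 n) (2 + 2)
                    (Fin.snoc (Fin.snoc (![((((omega0 M).rev, k), σ), 0), ((((omega0 M).rev, k), σ), 1)] : Fin 2 → HubbardFieldIdx L M)
                      ((p, 1) : HubbardFieldIdx L M) : Fin (2 + 1) → HubbardFieldIdx L M) (p, 0))).re)) / 4 +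
      (∑ σ : Fin 2,
          ((selfEnergy L M β
              (gaussConv ℂ (hubbardCovSliceCT L M β μ 0 K (klScale klE0 (n + 1)) (klScale klE0 n)) (klEffectiveAction L M β U μ K klE0 n) -
                klEffectiveAction L M β U μ K klE0 n -
                grassmannLaplacian ℂ (hubbardCovSliceCT L M β μ 0 K (klScale klE0 (n + 1)) (klScale klE0 n))
                  (klEffectiveAction L M β U μ K klE0 n)) (omega0 M, k) σ).re +
            (selfEnergy L M β
              (gaussConv ℂ (hubbardCovSliceCT L M β μ 0 K (klScale klE0 (n + 1)) (klScale klE0 n)) (klEffectiveAction L M β U μ K klE0 n) -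
                klEffectiveAction L M β U μ K klE0 n -
                grassmannLaplacian ℂ (hubbardCovSliceCT L M β μ 0 K (klScale klE0 (n + 1)) (klScale klE0 n))
                  (klEffectiveAction L M β U μ K klE0 n)) ((omega0 M).rev, k) σ).re)) / 4 +
      (∑ σ : Fin 2,
          ((selfEnergy L M β
              (effAction ℂ (hubbardCovSliceCT L M β μ 0 K (klScale klE0 (n + 1)) (klScale klE0 n)) (klEffectiveAction L M β U μ K klE0 n) -
                gaussConv ℂ (hubbardCovSliceCT L M β μ 0 K (klScale klE0 (n + 1)) (klScale klE0 n)) (klEffectiveAction L M β U μ K klE0 n))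
              (omega0 M, k) σ).re +
            (selfEnergy L M β
              (effAction ℂ (hubbardCovSliceCT L M β μ 0 K (klScale klE0 (n + 1)) (klScale klE0 n)) (klEffectiveAction L M β U μ K klE0 n) -
                gaussConv ℂ (hubbardCovSliceCT L M β μ 0 K (klScale klE0 (n + 1)) (klScale klE0 n)) (klEffectiveAction L M β U μ K klE0 n))
              ((omega0 M).rev, k) σ).re)) / 4 := by
  have h := fun (q : FreqMomentum L M) (σ : Fin 2) => klSelfEnergy_succ_sub_eq (L := L) (M := M) hβ U μ K n hZ q σ
  simp only [klLocSelfEnergyRe]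
  rw [← sub_div, ← Finset.sum_sub_distrib]
  have hpt : ∀ σ : Fin 2,
      ((klSelfEnergy L M β U μ K klE0 (n + 1) (omega0 M, k) σ).re + (klSelfEnergy L M β U μ K klE0 (n + 1) ((omega0 M).rev, k) σ).re) -
        ((klSelfEnergy L M β U μ K klE0 n (omega0 M, k) σ).re + (klSelfEnergy L M β U μ K klE0 n ((omega0 M).rev, k) σ).re) =
      (klSelfEnergy L M β U μ K klE0 (n + 1) (omega0 M, k) σ - klSelfEnergy L M β U μ K klE0 n (omega0 M, k) σ).re +
        (klSelfEnergy L M β U μ K klE0 (n + 1) ((omega0 M).rev, k) σ - klSelfEnergy L M β U μ K klE0 n ((omega0 M).rev, k) σ).re := by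
    intro σ
    simp only [Complex.sub_re]
    ring
  simp_rw [hpt, h, Complex.add_re]
  rw [← add_div, ← add_div, ← Finset.sum_add_distrib, ← Finset.sum_add_distrib]
  refine congrArg (· / (4 : ℝ)) (Finset.sum_congr rfl fun σ _ => ?_)
  ring

/-! ## §4 The scale-`n` increment of the local part `ν_n(K)(θ)` — the three LAYER-2 inputs by name -/

/-- **`ν_{n+1}(K)(θ) − ν_n(K)(θ) = I_L[tadpole reading](k_F^K θ) + I_L[R₁ reading](k_F^K θ) + I_L[R₂ reading](k_F^K θ)`** (`β ≠ 0`, `Z^K_{Λ_n} ≠ 0`):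
the increment of the cumulative local part at the FIXED frame `K` is the sum of the `C₄ᵥ`-symmetrised interpolants of the three lattice readings of §3,
evaluated at the frame's Fermi point. -/
theorem klLocalPart_succ_sub_eq {β : ℝ} (hβ : β ≠ 0) (U μ : ℝ) (K : TrigPolyC4v) (n : ℕ)
    (hZ : hubbardEffPartitionFnCT L M β U μ 0 K (klScale klE0 n) ≠ 0) (θ : ℝ) :
    klLocalPart L M β U μ K (n + 1) θ - klLocalPart L M β U μ K n θ =
      (symInterp L fun k : TorusSite 2 L =>
          (∑ σ : Fin 2,
            ((((((β * (L : ℝ) ^ 2) ^ 2 : ℝ) : ℂ))⁻¹ *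
                ∑ p : FreqMomentum L M × Fin 2,
                  sliceSymbolFnXi (β * (L : ℝ) ^ 2) 0 (klScale klE0 (n + 1)) (klScale klE0 n) (matsubaraFreq β M p.1.1) (nambuXiCT L μ K p.1.2) *
                    vertexFn L M β (klEffectiveAction L M β U μ K klE0 n) (2 + 2)
                      (Fin.snoc (Fin.snoc (![(((omega0 M, k), σ), 0), (((omega0 M, k), σ), 1)] : Fin 2 → HubbardFieldIdx L M)
                        ((p, 1) : HubbardFieldIdx L M) : Fin (2 + 1) → HubbardFieldIdx L M) (p, 0))).re +
              (((((β * (L : ℝ) ^ 2) ^ 2 : ℝ) : ℂ))⁻¹ *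
                ∑ p : FreqMomentum L M × Fin 2,
                  sliceSymbolFnXi (β * (L : ℝ) ^ 2) 0 (klScale klE0 (n + 1)) (klScale klE0 n) (matsubaraFreq β M p.1.1) (nambuXiCT L μ K p.1.2) *
                    vertexFn L M β (klEffectiveAction L M β U μ K klE0 n) (2 + 2)
                      (Fin.snoc (Fin.snoc (![((((omega0 M).rev, k), σ), 0), ((((omega0 M).rev, k), σ), 1)] : Fin 2 → HubbardFieldIdx L M)
                        ((p, 1) : HubbardFieldIdx L M) : Fin (2 + 1) → HubbardFieldIdx L M) (p, 0))).re)) / 4).eval (klFermiPoint μ K θ) +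
      (symInterp L fun k : TorusSite 2 L =>
          (∑ σ : Fin 2,
            ((selfEnergy L M β
                (gaussConv ℂ (hubbardCovSliceCT L M β μ 0 K (klScale klE0 (n + 1)) (klScale klE0 n)) (klEffectiveAction L M β U μ K klE0 n) -
                  klEffectiveAction L M β U μ K klE0 n -
                  grassmannLaplacian ℂ (hubbardCovSliceCT L M β μ 0 K (klScale klE0 (n + 1)) (klScale klE0 n))
                    (klEffectiveAction L M β U μ K klE0 n)) (omega0 M, k) σ).re +
              (selfEnergy L M β
                (gaussConv ℂ (hubbardCovSliceCT L M β μ 0 K (klScale klE0 (n + 1)) (klScale klE0 n)) (klEffectiveAction L M β U μ K klE0 n) -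
                  klEffectiveAction L M β U μ K klE0 n -
                  grassmannLaplacian ℂ (hubbardCovSliceCT L M β μ 0 K (klScale klE0 (n + 1)) (klScale klE0 n))
                    (klEffectiveAction L M β U μ K klE0 n)) ((omega0 M).rev, k) σ).re)) / 4).eval (klFermiPoint μ K θ) +
      (symInterp L fun k : TorusSite 2 L =>
          (∑ σ : Fin 2,
            ((selfEnergy L M β
                (effAction ℂ (hubbardCovSliceCT L M β μ 0 K (klScale klE0 (n + 1)) (klScale klE0 n)) (klEffectiveAction L M β U μ K klE0 n) -
                  gaussConv ℂ (hubbardCovSliceCT L M β μ 0 K (klScale klE0 (n + 1)) (klScale klE0 n)) (klEffectiveAction L M β U μ K klE0 n))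
                (omega0 M, k) σ).re +
              (selfEnergy L M β
                (effAction ℂ (hubbardCovSliceCT L M β μ 0 K (klScale klE0 (n + 1)) (klScale klE0 n)) (klEffectiveAction L M β U μ K klE0 n) -
                  gaussConv ℂ (hubbardCovSliceCT L M β μ 0 K (klScale klE0 (n + 1)) (klScale klE0 n)) (klEffectiveAction L M β U μ K klE0 n))
                ((omega0 M).rev, k) σ).re)) / 4).eval (klFermiPoint μ K θ) := by
  simp only [klLocalPart]
  rw [← eval_symInterp_add, ← eval_symInterp_add, ← eval_symInterp_sub]
  congr 2
  funext k
  exact klLocSelfEnergyRe_succ_sub_eq hβ U μ K n hZ k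

end Summit.HubbardSuperconductivity.HubbardSuperconductivity.Theorems.KLRegimeSplit

end
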